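import Literature.AlgebraicGeometry.ModuliOfAbelianVarieties.SiegelFineModuliScheme
import Literature.AlgebraicGeometry.AbelianSchemes.PolarizedAbelianSchemeWithLevelBaseChange
import Literature.AlgebraicGeometry.Morphisms.EtaleQuasiSectionOfFormallySmooth
import Mathlib.AlgebraicGeometry.Morphisms.Smooth
import Mathlib.AlgebraicGeometry.Morphisms.FiniteType
import Mathlib.AlgebraicGeometry.Noetherian
import HarnessLib

/-!
# Smoothness of a fine moduli scheme of polarised abelian schemes over `ℚ` from the ARTINIAN LIFTING of triples
# (EGA IV₄ (17.14.2) read through «fine moduli», [MumfordFogartyKirwan1994] Thm. 7.9 / [Lan2013PELCompactifications] §2.2)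

Layer `Literature/AlgebraicGeometry/ModuliOfAbelianVarieties`, namespace
`Literature.AlgebraicGeometry.ModuliOfAbelianVarieties.SiegelFineModuliScheme`.  THEOREMS ONLY (no definition, no named
fact, no instance, no `sorry`).  Cell `hodgecm-mathlib` (D-0151), F-DAG leaf **F-11 «`𝒜_{g,δ,N} → Spec ℚ` is SMOOTH»**,
ROAD A (Artinian lifting, hull-free) of the census `B-provers/B-p13/g20/CENSUS-F11-Smoothness.B-p13g20.md` — rows
**(A1) TRANSLATION** and **(A6) GLUE**; seat B-p05 (g18); first author of F-11 = B-p13 (g20).  HC_CM is proved only modulo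
the 7 printed citations until rung 0 closes; this file discharges none of them.

THE PRINT.  [EGAIV4] Prop. (17.14.2) (p. 98): «Soient `Y` un préschéma localement noethérien, `f : X → Y` un morphisme
localement de type fini, `x` un point de `X` … Pour que `f` soit lisse au point `x`, il faut et il suffit qu'il vérifie la
condition de (17.14.1) où l'on suppose de plus que l'anneau local `A′` est artinien, que `m′𝔍′ = 0` …» — the tree holds
the ring-level «il suffit» as ★ `Morphisms.isSmoothAt_of_artinianLifts` ([GortzWedhorn2023] Thm. 18.63 (ii)⇒(i)).
[Lan2013PELCompactifications] §2.2.1 (p. 130) / Prop. 2.2.4.? and [MumfordFogartyKirwan1994] Ch. 7 §3: for a FINE moduli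
scheme the test diagrams of (17.14.1) over `Spec A ⊇ Spec (A⧸J)` are exactly the problems «extend the triple
`(X₀, λ₀, σ₀)` over `Spec (A⧸J)` to a triple over `Spec A`» (the functor is represented: `classify`), so

  «every polarised abelian scheme of type `δ` with symplectic level-`N` structure over `Spec (A⧸J)`, `A` an Artinian
   local `ℚ`-algebra, `𝔪_A J = 0`, is the pull-back of one over `Spec A`»  ⟹  `𝒜_{g,δ,N} → Spec ℚ` is smooth

— the formal-smoothness-of-the-moduli-functor criterion ([Lan2013PELCompactifications] §2.2.1 «formally smooth»;
[SGA1] Exp. III; [Schlessinger1968] (2.5)/(2.10) for the pro-representable hull), stated here WITHOUT hulls, tangent spaces or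
obstruction groups.  The hypothesis is what ROAD A's rows (A2)–(A5) prove ((A2) level structures and the two Prop-clauses
lift for free, ★ `LevelStructure.existsUnique_baseChange_eq` / ★ `PolarizationClausesOfThickening`; (A4) abelian schemes are
unobstructed; (A5) the polarisation lifts); this file is the junction that turns their output into `Smooth 𝓜.M.hom`, the
`hF11` letter of the F-12 assembly.

WHAT IS HERE (`𝓜 : SiegelFineModuliScheme g N δ` — ★ carrier: `𝓜.M : SchemeOver ℚ`, universal triple `𝓜.univ`,
`classify`; plus `[LocallyOfFiniteType 𝓜.M.hom]`, which F-8/F-9 deliver):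
* §0 plumbing — morphisms into `Spec ℚ` are unique (`Subsingleton (ℚ →+* R)`), an open of a Jacobson space containing
  every closed point is everything;
* §1 **`mem_smoothLocus_of_isClosed_of_forall_smallExtension`** — (A1) at ONE closed point `x`: if every triple over
  `Spec (A⧸J)` (`A` Artinian local `ℚ`-algebra, `𝔪_A J = 0`) is a pull-back of a triple over `Spec A`, then `x` lies in the
  smooth locus of `𝓜.M → Spec ℚ`.  Proof = EGA (17.14.2) on an affine chart `W = Spec C ∋ x` (closed point ⇒ maximal
  ideal `q`, `π : C ↠ C⧸q`): a test map `g₀ : C → A⧸J` is an `A⧸J`-point `t₀` of `𝓜.M`; pull the universal triple back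
  along `t₀` (★ D-BC∃ `PolarizedAbelianSchemeWithLevel.baseChange`), lift it over `Spec A` by hypothesis, CLASSIFY the lift
  (`t : Spec A → 𝓜.M`), and `Spec (A⧸J) → Spec A → 𝓜.M` is `t₀` by uniqueness in `classify` (★ `classifyingMap_comp`,
  `eq_classifyingMap`); `t` factors through the chart (`Spec A` is one point) and is the wanted ring lift `C → A`
  (compatibility with `ℚ`-scalars is automatic: ring maps out of `Γ(Spec ℚ, 𝒪) ≅ ℚ` are unique);
* §2 **`smooth_of_forall_smallExtension_exists_isBaseChangeVia`** — (A6) GLUE: the same hypothesis at all Artinian local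
  `ℚ`-algebras gives `Smooth 𝓜.M.hom` (smooth locus open ⊇ closed points, `𝓜.M` Jacobson as a scheme locally of finite
  type over a field — Mathlib `LocallyOfFiniteType.jacobsonSpace`, `Scheme.Hom.smoothLocus_eq_top_iff`).

Not here: the converse (smooth ⇒ triples lift; true, not needed by F-12), the residue-field refinement of the test rings
(EGA: `A′/𝔪′ = k(x)`; every test ring this proof meets has residue field `κ(x)`, a number field, but the heads quantify
over all Artinian local `ℚ`-algebras — weaker conclusion for the consumer to prove is NOT claimed), hulls / `T¹` (ROAD T).


EDITION 2 (§3, B-p05 (g19)): the heads re-stated for GENUINE small extensions (`J ≠ ⊤`, the letter the road-A producers can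
discharge; the §1–§2 letter also covers `J = ⊤` over a field `A`, where it asks for a triple over every field of characteristic
`0` and is unsatisfiable for `N ≥ 3`): `mem_smoothLocus_of_isClosed_of_forall_smallExtension_ne_top`,
`smooth_of_forall_smallExtension_ne_top_exists_isBaseChangeVia`.

## References
* [EGAIV4] A. Grothendieck, J. Dieudonné, *Éléments de géométrie algébrique* IV₄, Publ. Math. IHÉS 32 (1967), Prop.
  (17.14.1)–(17.14.2) (p. 98), Déf. (17.3.7) (p. 62).
* [GortzWedhorn2023] U. Görtz, T. Wedhorn, *Algebraic Geometry II* (2023), Thm. 18.63.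
* [MumfordFogartyKirwan1994] D. Mumford, J. Fogarty, F. Kirwan, *Geometric Invariant Theory*, 3rd ed. (1994), Ch. 7 §2
  Def. 7.2–7.3 (p. 129), §3 Prop. 7.6 (p. 136), Thm. 7.9 (p. 139).
* [Lan2013PELCompactifications] K.-W. Lan, *Arithmetic compactifications of PEL-type Shimura varieties*, LMS Monographs 36
  (2013), §2.2.1 (p. 130), §2.2.4 (pp. 142–150), Thm. 1.4.1.11 (p. 91).
* [SGA1] A. Grothendieck, *SGA 1* (LNM 224), Exp. III Thm. 3.1, Cor. 5.1.
* [Schlessinger1968] M. Schlessinger, *Functors of Artin rings*, Trans. AMS 130 (1968), (2.5), Prop. (2.10).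
-/

noncomputable section

universe u

open CategoryTheory CategoryTheory.Limits AlgebraicGeometry IsLocalRing TopologicalSpace

namespace Literature.AlgebraicGeometry.ModuliOfAbelianVarieties

open Literature.AlgebraicGeometry.Motives (SchemeOver specOver)
open Literature.AlgebraicGeometry.AbelianSchemes (PolarizedAbelianSchemeWithLevel)

namespace SiegelFineModuliScheme

/-! ## §0 Plumbing: maps to `Spec ℚ` are unique; opens of a Jacobson space containing the closed points -/

/-- Ring homomorphisms out of a ring isomorphic to `ℚ` agree (Mathlib `Rat.subsingleton_ringHom`, transported along
`e : ℚ ≃+* R` — used for `R = Γ(Spec ℚ, 𝒪)`). [folklore] -/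
private theorem ringHom_ext_of_ratEquiv {R A : Type*} [Semiring R] [Semiring A] (e : ℚ ≃+* R) (φ ψ : R →+* A) :
    φ = ψ := by
  have h : φ.comp e.toRingHom = ψ.comp e.toRingHom := Subsingleton.elim _ _
  refine RingHom.ext fun r => ?_
  obtain ⟨q, rfl⟩ := e.surjective r
  exact congr($h q)

/-- Any two morphisms of schemes `X → Spec ℚ` coincide (`Γ ⊣ Spec`: they correspond to ring maps `ℚ → Γ(X, 𝒪_X)`,
which are unique) — so every triangle over `Spec ℚ` commutes. [folklore] -/
private theorem hom_ext_specRat {X : Scheme.{0}} (a b : X ⟶ Spec (.of ℚ)) : a = b := by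
  apply (ΓSpec.adjunction.homEquiv X (Opposite.op (CommRingCat.of ℚ))).symm.injective
  apply Quiver.Hom.unop_inj
  ext1
  exact Subsingleton.elim _ _

/-- In a Jacobson space an open subset containing every closed point is the whole space (its closed complement would
contain a closed point, Mathlib `nonempty_inter_closedPoints`). [folklore] -/
private theorem opens_eq_top_of_closedPoints_subset {X : Type*} [TopologicalSpace X] [JacobsonSpace X] (U : Opens X)
    (h : closedPoints X ⊆ (U : Set X)) : U = ⊤ := by
  by_contra hU
  have hne : ((U : Set X)ᶜ).Nonempty := by
    rw [Set.nonempty_compl]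
    exact fun h' => hU (Opens.ext (h'.trans Opens.coe_top.symm))
  obtain ⟨y, hyU, hy⟩ := nonempty_inter_closedPoints hne U.2.isClosed_compl.isLocallyClosed
  exact hyU (h hy)

/-! ## §1 (A1) One closed point: Artinian lifting of triples ⟹ the point is in the smooth locus -/

variable {g N : ℕ} {δ : Fin g → ℕ} (𝓜 : SiegelFineModuliScheme g N δ)

set_option backward.isDefEq.respectTransparency false in
/-- **(A1) EGA IV₄ (17.14.2) read through «fine moduli», at a closed point.**  Let `𝓜` be a fine moduli scheme of
polarised abelian schemes of type `δ` with symplectic level-`N` structure over `ℚ` (★ `SiegelFineModuliScheme`), locally of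
finite type over `ℚ`, and `x` a CLOSED point of `𝓜.M`.  Suppose that for every Artinian local `ℚ`-algebra `A` and every
ideal `J` with `𝔪_A · J = 0`, every triple `P₀` over `Spec (A⧸J)` is the pull-back (★ `IsBaseChangeVia`) of some triple `P`
over `Spec A` along `Spec (A⧸J) → Spec A`.  Then `x` lies in the smooth locus of `𝓜.M → Spec ℚ`.  (Chart `W = Spec C ∋ x`,
`q` the maximal ideal of `x`; the ring-level criterion ★ `Morphisms.isSmoothAt_of_artinianLifts` asks to lift
`g₀ : C → A⧸J` to `C → A`: `g₀` is an `A⧸J`-point of `𝓜.M`, the universal triple pulls back along it (★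
`PolarizedAbelianSchemeWithLevel.baseChange`), the pull-back lifts over `Spec A` by hypothesis, the lift is CLASSIFIED by
`t : Spec A → 𝓜.M` and `Spec (A⧸J) → Spec A → 𝓜.M` is the original point by uniqueness in `classify`; `t` factors through
`W` and is the ring lift.) [cite: EGAIV4, Prop. (17.14.2) p. 98] [cite: MumfordFogartyKirwan1994, Ch. 7 §3 Theorem 7.9 (p. 139)]
[cite: Lan2013PELCompactifications, §2.2.1 (p. 130)] -/
theorem mem_smoothLocus_of_isClosed_of_forall_smallExtension [LocallyOfFiniteType 𝓜.M.hom]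
    (H : ∀ (A : Type) [CommRing A] [Algebra ℚ A] [IsArtinianRing A] [IsLocalRing A] (J : Ideal A),
      maximalIdeal A * J = ⊥ →
      ∀ P₀ : PolarizedAbelianSchemeWithLevel g N δ (Spec (.of (A ⧸ J))),
        ∃ (P : PolarizedAbelianSchemeWithLevel g N δ (Spec (.of A)))
          (G : P₀.A.X.left ⟶ P.A.X.left) (Ĝ : P₀.D.hat.X.left ⟶ P.D.hat.X.left),
          P₀.IsBaseChangeVia P (Spec.map (CommRingCat.ofHom (Ideal.Quotient.mk J))) G Ĝ)
    (x : 𝓜.M.left) (hx : IsClosed ({x} : Set 𝓜.M.left)) : x ∈ 𝓜.M.hom.smoothLocus := by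
  classical
  -- (b) the affine chart: `W ∋ x` in `𝓜.M`, the whole of `Spec ℚ` on the base
  have hU : IsAffineOpen (⊤ : (Spec (CommRingCat.of ℚ)).Opens) := isAffineOpen_top _
  obtain ⟨_, ⟨W, hW, rfl⟩, hxW, -⟩ :=
    𝓜.M.left.isBasis_affineOpens.exists_subset_of_mem_open (Set.mem_univ x) isOpen_univ
  have hWU : W ≤ 𝓜.M.hom ⁻¹ᵁ ⊤ := le_top
  haveI : IsNoetherianRing Γ(Spec (CommRingCat.of ℚ), ⊤) := IsLocallyNoetherian.component_noetherian ⟨⊤, hU⟩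
  have hft : (𝓜.M.hom.appLE ⊤ W hWU).hom.FiniteType := 𝓜.M.hom.finiteType_appLE hU hW hWU
  algebraize [(𝓜.M.hom.appLE ⊤ W hWU).hom]
  rw [Scheme.Hom.mem_smoothLocus, formallySmooth_stalkMap_iff ⊤ hU W hW hWU hxW]
  change Algebra.IsSmoothAt Γ(Spec (CommRingCat.of ℚ), ⊤) (hW.primeIdealOf ⟨x, hxW⟩).asIdeal
  -- (c) the closed point as a surjection `C ↠ C ⧸ q`, `q` maximal
  haveI hqmax : (hW.primeIdealOf ⟨x, hxW⟩).asIdeal.IsMaximal := hW.primeIdealOf_isMaximal_of_isClosed ⟨x, hxW⟩ hx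
  letI := Ideal.Quotient.field (hW.primeIdealOf ⟨x, hxW⟩).asIdeal
  refine Literature.AlgebraicGeometry.Morphisms.isSmoothAt_of_artinianLifts
    (Ideal.Quotient.mkₐ Γ(Spec (CommRingCat.of ℚ), ⊤) (hW.primeIdealOf ⟨x, hxW⟩).asIdeal)
    (Ideal.Quotient.mkₐ_surjective Γ(Spec (CommRingCat.of ℚ), ⊤) _) (hW.primeIdealOf ⟨x, hxW⟩).asIdeal
    (Ideal.Quotient.mkₐ_ker Γ(Spec (CommRingCat.of ℚ), ⊤) _) ?_
  -- (d) the lifting property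
  intro A _ _ _ _ J hJ g₀ ε hε
  haveI : Nontrivial (A ⧸ J) := ε.toRingHom.domain_nontrivial
  -- `A` as a `ℚ`-algebra (through `Γ(Spec ℚ, 𝒪) ≅ ℚ`)
  let e : ℚ ≃+* Γ(Spec (CommRingCat.of ℚ), ⊤) := (Scheme.ΓSpecIso (CommRingCat.of ℚ)).commRingCatIsoToRingEquiv.symm
  letI : Algebra ℚ A := ((algebraMap Γ(Spec (CommRingCat.of ℚ), ⊤) A).comp e.toRingHom).toAlgebra
  -- the `A ⧸ J`-point of `𝓜.M` through the chart and the pulled-back universal triple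
  let t₀ : Spec (CommRingCat.of (A ⧸ J)) ⟶ 𝓜.M.left := Spec.map (CommRingCat.ofHom g₀.toRingHom) ≫ hW.fromSpec
  obtain ⟨P, G, Ĝ, hP⟩ := H A J hJ (𝓜.univ.baseChange t₀)
  -- classify the lift over `Spec A`
  let T : SchemeOver ℚ := specOver ℚ A
  let T₀ : SchemeOver ℚ := specOver ℚ (A ⧸ J)
  haveI : IsLocallyNoetherian T.left := inferInstanceAs (IsLocallyNoetherian (Spec (CommRingCat.of A)))
  haveI : IsLocallyNoetherian T₀.left := inferInstanceAs (IsLocallyNoetherian (Spec (CommRingCat.of (A ⧸ J))))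
  let i : Spec (CommRingCat.of (A ⧸ J)) ⟶ Spec (CommRingCat.of A) :=
    Spec.map (CommRingCat.ofHom (Ideal.Quotient.mk J))
  let s : T₀ ⟶ T := Over.homMk i (hom_ext_specRat _ _)
  let t : Spec (CommRingCat.of A) ⟶ 𝓜.M.left := (𝓜.classifyingMap T P).left
  let t₀' : T₀ ⟶ 𝓜.M := Over.homMk t₀ (hom_ext_specRat _ _)
  have ht₀ : t₀' = 𝓜.classifyingMap T₀ (𝓜.univ.baseChange t₀) :=
    𝓜.eq_classifyingMap T₀ (𝓜.univ.baseChange t₀) t₀' ⟨_, _, 𝓜.univ.baseChange_isBaseChangeVia t₀⟩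
  have hs : s ≫ 𝓜.classifyingMap T P = 𝓜.classifyingMap T₀ (𝓜.univ.baseChange t₀) :=
    𝓜.classifyingMap_comp s P (𝓜.univ.baseChange t₀) hP
  have hlift : i ≫ t = t₀ := by
    have h := congrArg CommaMorphism.left (hs.trans ht₀.symm)
    simp only [s, t₀', Over.comp_left, Over.homMk_left] at h
    exact h
  -- (e) `t` lands in `W`: `Spec A` is one point, hit by `Spec (A ⧸ J)`
  have hsurj : Function.Surjective i := by
    intro y
    obtain ⟨M, hM⟩ := Ideal.exists_maximal (A ⧸ J)
    refine ⟨(⟨M, hM.isPrime⟩ : PrimeSpectrum (A ⧸ J)), PrimeSpectrum.ext ?_⟩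
    rw [IsLocalRing.eq_maximalIdeal (IsArtinianRing.isMaximal_of_isPrime y.asIdeal)]
    exact IsLocalRing.eq_maximalIdeal (IsArtinianRing.isMaximal_of_isPrime _)
  have hpt : ∀ y, t y ∈ W := by
    intro y
    obtain ⟨z, rfl⟩ := hsurj y
    rw [← Scheme.Hom.comp_apply, hlift, Scheme.Hom.comp_apply]
    have := Set.mem_range_self (f := fun u => hW.fromSpec u) (Spec.map (CommRingCat.ofHom g₀.toRingHom) z)
    rwa [hW.range_fromSpec] at this
  have hrange : Set.range t ⊆ Set.range (Scheme.Opens.ι W) := by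
    rintro _ ⟨y, rfl⟩
    rw [Scheme.Opens.range_ι]
    exact hpt y
  let ℓ := IsOpenImmersion.lift (Scheme.Opens.ι W) t hrange
  have hℓ : ℓ ≫ Scheme.Opens.ι W = t := IsOpenImmersion.lift_fac _ t hrange
  obtain ⟨gC, hgC⟩ := Spec.map_surjective (ℓ ≫ hW.isoSpec.hom)
  have hgC' : Spec.map gC ≫ hW.fromSpec = t := by
    rw [hgC, Category.assoc, ← IsAffineOpen.isoSpec_inv_ι, Iso.hom_inv_id_assoc, hℓ]
  -- (f) the ring map `gC : C → A` is an algebra lift of `g₀`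
  have hR1 : 𝓜.M.hom.appLE ⊤ W hWU ≫ gC = CommRingCat.ofHom (algebraMap Γ(Spec (CommRingCat.of ℚ), ⊤) A) := by
    ext1
    exact ringHom_ext_of_ratEquiv e _ _
  have hR2 : gC ≫ CommRingCat.ofHom (Ideal.Quotient.mk J) = CommRingCat.ofHom g₀.toRingHom := by
    have h := hlift
    rw [← hgC', ← Spec.map_comp_assoc, cancel_mono] at h
    exact Spec.map_injective h
  let gA : Γ(𝓜.M.left, W) →ₐ[Γ(Spec (CommRingCat.of ℚ), ⊤)] A :=
    ⟨gC.hom, fun r => congr(($hR1).hom r)⟩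
  refine ⟨gA, AlgHom.ext fun c => ?_⟩
  exact congr(($hR2).hom c)

/-! ## §2 (A6) Glue: all closed points ⟹ `Smooth 𝓜.M.hom` -/

/-- **(A6) F-11 from the Artinian lifting of triples** ([EGAIV4] (17.14.2) + «fine moduli» [MumfordFogartyKirwan1994] Thm. 7.9;
[Lan2013PELCompactifications] §2.2.1 «formal smoothness» of the moduli problem): let `𝓜` be a fine moduli scheme of
polarised abelian schemes of type `δ` with symplectic level-`N` structure over `ℚ`, locally of finite type over `ℚ`.  If
for every Artinian local `ℚ`-algebra `A` and every ideal `J` with `𝔪_A · J = 0` every triple over `Spec (A⧸J)` is the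
pull-back of a triple over `Spec A`, then **`𝓜.M → Spec ℚ` is smooth**.  (§1 at every closed point; the smooth locus is
open and `𝓜.M` is a Jacobson space — Mathlib `LocallyOfFiniteType.jacobsonSpace` over the Jacobson scheme `Spec ℚ` — so
an open containing all closed points is everything; `Scheme.Hom.smoothLocus_eq_top_iff`.)  This is the `hF11` junction
of ROAD A: rows (A2)–(A5) prove the hypothesis. [cite: EGAIV4, Prop. (17.14.2) p. 98] [cite: MumfordFogartyKirwan1994, Ch. 7 §3 Theorem 7.9 (p. 139)]
[cite: Lan2013PELCompactifications, §2.2.1 (p. 130)] -/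
theorem smooth_of_forall_smallExtension_exists_isBaseChangeVia [LocallyOfFiniteType 𝓜.M.hom]
    (H : ∀ (A : Type) [CommRing A] [Algebra ℚ A] [IsArtinianRing A] [IsLocalRing A] (J : Ideal A),
      maximalIdeal A * J = ⊥ →
      ∀ P₀ : PolarizedAbelianSchemeWithLevel g N δ (Spec (.of (A ⧸ J))),
        ∃ (P : PolarizedAbelianSchemeWithLevel g N δ (Spec (.of A)))
          (G : P₀.A.X.left ⟶ P.A.X.left) (Ĝ : P₀.D.hat.X.left ⟶ P.D.hat.X.left),
          P₀.IsBaseChangeVia P (Spec.map (CommRingCat.ofHom (Ideal.Quotient.mk J))) G Ĝ) :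
    Smooth 𝓜.M.hom := by
  rw [← Scheme.Hom.smoothLocus_eq_top_iff]
  haveI : JacobsonSpace 𝓜.M.left := LocallyOfFiniteType.jacobsonSpace 𝓜.M.hom
  exact opens_eq_top_of_closedPoints_subset _ fun x hx =>
    𝓜.mem_smoothLocus_of_isClosed_of_forall_smallExtension H x hx


/-! ## §3 (edition 2) The letter consumers can discharge: small extensions with `J ≠ ⊤`

EDITION 2 (B-p05 (g19), 2026-08-30; F-11 road A, count-neutral).  The hypothesis `H` of §1–§2 quantifies over ALL ideals `J`
with `𝔪_A · J = 0`, including `J = ⊤` when `A` is a FIELD (then `𝔪_A = 0`): there `Spec (A ⧸ J) = ∅` carries the EMPTY triple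
whenever `δ` is a polarisation type, and `H` would demand a triple of type `(g, N, δ)` over `Spec K` for every field `K` of
characteristic `0` — impossible for `N ≥ 3` already over `K = ℚ` (a full symplectic level-`N` structure rational over `K`
forces `μ_N ⊂ K` by the Weil pairing).  So `H` as printed in §1 is UNSATISFIABLE for the levels the moduli consumer uses, and
the road-A producers ((A2)–(A5)) cannot feed it.  The proof of §1 only ever meets `J` with `A ⧸ J` NON-TRIVIAL (the test
algebra `A ⧸ J` maps to the residue field `κ(x)`), i.e. GENUINE small extensions `0 → J → A → A ⧸ J → 0`, `J ⊆ 𝔪_A`,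
`𝔪_A J = 0` (the «small extensions» of deformation theory; [EGAIV4] (17.14.2) tests `A → A ⧸ J` with `J` nilpotent).  This
section re-states both heads with the dischargeable letter `H♭ : ∀ A J, J ≠ ⊤ → 𝔪_A J = 0 → …` (same proof, one extra line:
`J ≠ ⊤` from `Nontrivial (A ⧸ J)`).  The §1–§2 heads stay (true, weaker, unused). -/

set_option backward.isDefEq.respectTransparency false in
/-- **(A1♭) EGA IV₄ (17.14.2) through «fine moduli» at a closed point — GENUINE small extensions only.**  As
`mem_smoothLocus_of_isClosed_of_forall_smallExtension`, but the lifting hypothesis is asked only for ideals `J ≠ ⊤` with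
`𝔪_A · J = 0` (equivalently `J ⊆ 𝔪_A`, `𝔪_A J = 0`: a small extension `A ↠ A ⧸ J` of Artinian local `ℚ`-algebras), which is the
letter the road-A producers prove.  (Same chart / classification argument; the test algebras `A ⧸ J` of ★
`Morphisms.isSmoothAt_of_artinianLifts` are augmented over the residue field `κ(x)`, hence non-trivial, hence `J ≠ ⊤`.)
[cite: EGAIV4, Prop. (17.14.2) p. 98] [cite: MumfordFogartyKirwan1994, Ch. 7 §3 Theorem 7.9 (p. 139)]
[cite: Lan2013PELCompactifications, §2.2.1 (p. 130)] -/
theorem mem_smoothLocus_of_isClosed_of_forall_smallExtension_ne_top [LocallyOfFiniteType 𝓜.M.hom]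
    (H : ∀ (A : Type) [CommRing A] [Algebra ℚ A] [IsArtinianRing A] [IsLocalRing A] (J : Ideal A),
      J ≠ ⊤ → maximalIdeal A * J = ⊥ →
      ∀ P₀ : PolarizedAbelianSchemeWithLevel g N δ (Spec (.of (A ⧸ J))),
        ∃ (P : PolarizedAbelianSchemeWithLevel g N δ (Spec (.of A)))
          (G : P₀.A.X.left ⟶ P.A.X.left) (Ĝ : P₀.D.hat.X.left ⟶ P.D.hat.X.left),
          P₀.IsBaseChangeVia P (Spec.map (CommRingCat.ofHom (Ideal.Quotient.mk J))) G Ĝ)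
    (x : 𝓜.M.left) (hx : IsClosed ({x} : Set 𝓜.M.left)) : x ∈ 𝓜.M.hom.smoothLocus := by
  classical
  -- (b) the affine chart: `W ∋ x` in `𝓜.M`, the whole of `Spec ℚ` on the base
  have hU : IsAffineOpen (⊤ : (Spec (CommRingCat.of ℚ)).Opens) := isAffineOpen_top _
  obtain ⟨_, ⟨W, hW, rfl⟩, hxW, -⟩ :=
    𝓜.M.left.isBasis_affineOpens.exists_subset_of_mem_open (Set.mem_univ x) isOpen_univ
  have hWU : W ≤ 𝓜.M.hom ⁻¹ᵁ ⊤ := le_top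
  haveI : IsNoetherianRing Γ(Spec (CommRingCat.of ℚ), ⊤) := IsLocallyNoetherian.component_noetherian ⟨⊤, hU⟩
  have hft : (𝓜.M.hom.appLE ⊤ W hWU).hom.FiniteType := 𝓜.M.hom.finiteType_appLE hU hW hWU
  algebraize [(𝓜.M.hom.appLE ⊤ W hWU).hom]
  rw [Scheme.Hom.mem_smoothLocus, formallySmooth_stalkMap_iff ⊤ hU W hW hWU hxW]
  change Algebra.IsSmoothAt Γ(Spec (CommRingCat.of ℚ), ⊤) (hW.primeIdealOf ⟨x, hxW⟩).asIdeal
  -- (c) the closed point as a surjection `C ↠ C ⧸ q`, `q` maximal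
  haveI hqmax : (hW.primeIdealOf ⟨x, hxW⟩).asIdeal.IsMaximal := hW.primeIdealOf_isMaximal_of_isClosed ⟨x, hxW⟩ hx
  letI := Ideal.Quotient.field (hW.primeIdealOf ⟨x, hxW⟩).asIdeal
  refine Literature.AlgebraicGeometry.Morphisms.isSmoothAt_of_artinianLifts
    (Ideal.Quotient.mkₐ Γ(Spec (CommRingCat.of ℚ), ⊤) (hW.primeIdealOf ⟨x, hxW⟩).asIdeal)
    (Ideal.Quotient.mkₐ_surjective Γ(Spec (CommRingCat.of ℚ), ⊤) _) (hW.primeIdealOf ⟨x, hxW⟩).asIdeal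
    (Ideal.Quotient.mkₐ_ker Γ(Spec (CommRingCat.of ℚ), ⊤) _) ?_
  -- (d) the lifting property
  intro A _ _ _ _ J hJ g₀ ε hε
  haveI : Nontrivial (A ⧸ J) := ε.toRingHom.domain_nontrivial
  -- (edition 2) the test extension is a genuine small extension: `A ⧸ J ≠ 0`, i.e. `J ≠ ⊤`
  have hJtop : J ≠ ⊤ := Ideal.Quotient.nontrivial_iff.mp inferInstance
  -- `A` as a `ℚ`-algebra (through `Γ(Spec ℚ, 𝒪) ≅ ℚ`)
  let e : ℚ ≃+* Γ(Spec (CommRingCat.of ℚ), ⊤) := (Scheme.ΓSpecIso (CommRingCat.of ℚ)).commRingCatIsoToRingEquiv.symm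
  letI : Algebra ℚ A := ((algebraMap Γ(Spec (CommRingCat.of ℚ), ⊤) A).comp e.toRingHom).toAlgebra
  -- the `A ⧸ J`-point of `𝓜.M` through the chart and the pulled-back universal triple
  let t₀ : Spec (CommRingCat.of (A ⧸ J)) ⟶ 𝓜.M.left := Spec.map (CommRingCat.ofHom g₀.toRingHom) ≫ hW.fromSpec
  obtain ⟨P, G, Ĝ, hP⟩ := H A J hJtop hJ (𝓜.univ.baseChange t₀)
  -- classify the lift over `Spec A`
  let T : SchemeOver ℚ := specOver ℚ A
  let T₀ : SchemeOver ℚ := specOver ℚ (A ⧸ J)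
  haveI : IsLocallyNoetherian T.left := inferInstanceAs (IsLocallyNoetherian (Spec (CommRingCat.of A)))
  haveI : IsLocallyNoetherian T₀.left := inferInstanceAs (IsLocallyNoetherian (Spec (CommRingCat.of (A ⧸ J))))
  let i : Spec (CommRingCat.of (A ⧸ J)) ⟶ Spec (CommRingCat.of A) :=
    Spec.map (CommRingCat.ofHom (Ideal.Quotient.mk J))
  let s : T₀ ⟶ T := Over.homMk i (hom_ext_specRat _ _)
  let t : Spec (CommRingCat.of A) ⟶ 𝓜.M.left := (𝓜.classifyingMap T P).left
  let t₀' : T₀ ⟶ 𝓜.M := Over.homMk t₀ (hom_ext_specRat _ _)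
  have ht₀ : t₀' = 𝓜.classifyingMap T₀ (𝓜.univ.baseChange t₀) :=
    𝓜.eq_classifyingMap T₀ (𝓜.univ.baseChange t₀) t₀' ⟨_, _, 𝓜.univ.baseChange_isBaseChangeVia t₀⟩
  have hs : s ≫ 𝓜.classifyingMap T P = 𝓜.classifyingMap T₀ (𝓜.univ.baseChange t₀) :=
    𝓜.classifyingMap_comp s P (𝓜.univ.baseChange t₀) hP
  have hlift : i ≫ t = t₀ := by
    have h := congrArg CommaMorphism.left (hs.trans ht₀.symm)
    simp only [s, t₀', Over.comp_left, Over.homMk_left] at h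
    exact h
  -- (e) `t` lands in `W`: `Spec A` is one point, hit by `Spec (A ⧸ J)`
  have hsurj : Function.Surjective i := by
    intro y
    obtain ⟨M, hM⟩ := Ideal.exists_maximal (A ⧸ J)
    refine ⟨(⟨M, hM.isPrime⟩ : PrimeSpectrum (A ⧸ J)), PrimeSpectrum.ext ?_⟩
    rw [IsLocalRing.eq_maximalIdeal (IsArtinianRing.isMaximal_of_isPrime y.asIdeal)]
    exact IsLocalRing.eq_maximalIdeal (IsArtinianRing.isMaximal_of_isPrime _)
  have hpt : ∀ y, t y ∈ W := by
    intro y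
    obtain ⟨z, rfl⟩ := hsurj y
    rw [← Scheme.Hom.comp_apply, hlift, Scheme.Hom.comp_apply]
    have := Set.mem_range_self (f := fun u => hW.fromSpec u) (Spec.map (CommRingCat.ofHom g₀.toRingHom) z)
    rwa [hW.range_fromSpec] at this
  have hrange : Set.range t ⊆ Set.range (Scheme.Opens.ι W) := by
    rintro _ ⟨y, rfl⟩
    rw [Scheme.Opens.range_ι]
    exact hpt y
  let ℓ := IsOpenImmersion.lift (Scheme.Opens.ι W) t hrange
  have hℓ : ℓ ≫ Scheme.Opens.ι W = t := IsOpenImmersion.lift_fac _ t hrange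
  obtain ⟨gC, hgC⟩ := Spec.map_surjective (ℓ ≫ hW.isoSpec.hom)
  have hgC' : Spec.map gC ≫ hW.fromSpec = t := by
    rw [hgC, Category.assoc, ← IsAffineOpen.isoSpec_inv_ι, Iso.hom_inv_id_assoc, hℓ]
  -- (f) the ring map `gC : C → A` is an algebra lift of `g₀`
  have hR1 : 𝓜.M.hom.appLE ⊤ W hWU ≫ gC = CommRingCat.ofHom (algebraMap Γ(Spec (CommRingCat.of ℚ), ⊤) A) := by
    ext1
    exact ringHom_ext_of_ratEquiv e _ _
  have hR2 : gC ≫ CommRingCat.ofHom (Ideal.Quotient.mk J) = CommRingCat.ofHom g₀.toRingHom := by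
    have h := hlift
    rw [← hgC', ← Spec.map_comp_assoc, cancel_mono] at h
    exact Spec.map_injective h
  let gA : Γ(𝓜.M.left, W) →ₐ[Γ(Spec (CommRingCat.of ℚ), ⊤)] A :=
    ⟨gC.hom, fun r => congr(($hR1).hom r)⟩
  refine ⟨gA, AlgHom.ext fun c => ?_⟩
  exact congr(($hR2).hom c)

/-- **(A6♭) F-11 from the Artinian lifting of triples along GENUINE small extensions.**  Let `𝓜` be a fine moduli scheme of
polarised abelian schemes of type `δ` with symplectic level-`N` structure over `ℚ`, locally of finite type over `ℚ`.  If for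
every Artinian local `ℚ`-algebra `A` and every ideal `J ≠ ⊤` with `𝔪_A · J = 0` every triple over `Spec (A⧸J)` is the
pull-back of a triple over `Spec A`, then **`𝓜.M → Spec ℚ` is smooth** (§3 (A1♭) at every closed point + the Jacobson argument
of §2).  This is the `hF11` junction of ROAD A in the letter its producers can discharge.
[cite: EGAIV4, Prop. (17.14.2) p. 98] [cite: MumfordFogartyKirwan1994, Ch. 7 §3 Theorem 7.9 (p. 139)]
[cite: Lan2013PELCompactifications, §2.2.1 (p. 130)] -/
theorem smooth_of_forall_smallExtension_ne_top_exists_isBaseChangeVia [LocallyOfFiniteType 𝓜.M.hom]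
    (H : ∀ (A : Type) [CommRing A] [Algebra ℚ A] [IsArtinianRing A] [IsLocalRing A] (J : Ideal A),
      J ≠ ⊤ → maximalIdeal A * J = ⊥ →
      ∀ P₀ : PolarizedAbelianSchemeWithLevel g N δ (Spec (.of (A ⧸ J))),
        ∃ (P : PolarizedAbelianSchemeWithLevel g N δ (Spec (.of A)))
          (G : P₀.A.X.left ⟶ P.A.X.left) (Ĝ : P₀.D.hat.X.left ⟶ P.D.hat.X.left),
          P₀.IsBaseChangeVia P (Spec.map (CommRingCat.ofHom (Ideal.Quotient.mk J))) G Ĝ) :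
    Smooth 𝓜.M.hom := by
  rw [← Scheme.Hom.smoothLocus_eq_top_iff]
  haveI : JacobsonSpace 𝓜.M.left := LocallyOfFiniteType.jacobsonSpace 𝓜.M.hom
  exact opens_eq_top_of_closedPoints_subset _ fun x hx =>
    𝓜.mem_smoothLocus_of_isClosed_of_forall_smallExtension_ne_top H x hx

end SiegelFineModuliScheme

end Literature.AlgebraicGeometry.ModuliOfAbelianVarieties

end
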